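import Summits.QuantumFields.YangMills.Theorems.BalabanUVNodesN15CovariantLandauFlatRowsKing
import Summits.QuantumFields.YangMills.Theorems.BalabanUVNodesN15KingModelFullPropagatorOperatorPrinted
import Summits.QuantumFields.YangMills.Theorems.BalabanUVNodesN15KingModelFullPropagatorOperatorEntries
import HarnessLib

/-!
# Route «BalabanUVNodes», node N15 = NE2, road (c) — THE THREE FLAT **TWO-GRID** KERNEL ROWS OF THE LANDAU LETTER's PRIMITIVE FAMILY —
# the η-defects `G″(1)P̂ − P̂G′(1)`, `∂″G″(1)P̂ − P̂∂′G′(1)`, `G″(1)∂″ᵀP̂ − P̂G′(1)∂′ᵀ` between the spacings `η = L^{−K}` and `η′ = L^{−n}η` through King's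
# pairing `P̂ = pull ∘ liftMap pr` — PROVED ON KING's TORUS FAMILY FROM THE KING-MODEL RUNG (dag-n15-e's two-spacing η-rates WITH decay,
# `fullPropOp∕DOp∕AdjOp_rate_printed`, uniform in `K`, `n`, the volume and the mass) at the PAIRED couplings `a_K·N^{d+1}` ∕ `a_{K+n}·N′^{d+1}`, passed to
# `m² = 0` by continuity and lifted to the coloured carriers (dag-n15-a g34, (Ξ-1) = the two-grid twin of n15-c∕220 `…CovariantLandauFlatRowsKing`)

Cell `pub-ymgap`, seat `pub-ymgap-dag-n15-a` (generation g34; KNIT-BY-NAME lane; HUMAN RULING D-0062; chair R424 venue).  `bears_on: R4∕N15 · K3⁸ SpineGivenEndpointR13SepCoPHV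
(stmt-QuantumFields-27366)`; filed `--supports stmt-QuantumFields-27366 --as helper` — COUNT-NEUTRAL.  Theorems only; 0 `sorry`; HYPOTHESIS-FREE on King's torus family `M_μ = 2L^e`,
coarse run `N = L^K` (`K ≥ 1`), fine run `N′ = L^nL^K` (`n ≥ 1`), `L` odd `≥ 3`, `a₀ > 0`, rate exponent `0 ≤ γ < 1∕2`.  Imports BY NAME: n15-c∕220 `…CovariantLandauFlatRowsKing`
(`hasMaj_of_kingDecay`'s pattern, §1 dictionary `greenFlat_eq_fineOp_inv`, `gradFlat_transpose_mulVec`, `mulVecLin_kronecker_one_rect`; through it n15-c∕197∕200 `cGreen_one`, `cgrad_one`,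
`gradFlat_apply`, dag-n15-a `abs_le_of_Ioc`, n15-c g7 `continuousAt_fineOp_inv_mulVec_mass`, M4 `hasMaj_tensorId`), dag-n15-e `…KingModelFullPropagatorOperatorPrinted` (★ `fullPropOp_rate_printed`)
and `…KingModelFullPropagatorOperatorEntries` (★ `fullPropDOp_rate_printed`, ★ `fullPropAdjOp_rate_printed`): King's Prop. 3.8 (3.71) two-spacing rates of the FULL `A = 0` propagator, its
gradient and its transposed gradient, as operators on η-lattice sources WITH the (3.7)∕(1.10) decay from the support, kernel-checked; `blockOf_underPtN`.  Nothing in the tree is modified.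

WHY.  After n15-c∕234 ∕ dag-n15-a (♭-8b) the road-(c) literal `sfObjects₈qvr` is `Live ∧ N15At` modulo ONE displayed row, the two-grid η-defect of the Landau letter `N_V^R` (dag-n15-c g24's
object (G3)); n15-c g24 reduces it (n15-c∕235–236, 234′) to FLAT TWO-GRID KERNEL ROWS of `G′(1)`, `∂G′(1)`, `G′(1)∂ᵀ` (+ the flat one-grid rows, theorems by n15-c∕220∕222b).  The model's flat
operator IS King's: `Δ′_a(1) = ∂ᵀ∂ + a′n^{d+1}Q′ᵀQ′ = fineOp n M a′ n² 0` (n15-c∕220 `lapAFlat_eq_fineOp`), King's pairing `kingPr L K n M` IS dag-n15-e's `underPtN L K n M` (same text), and the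
rung's TWO-SPACING theorems compare `(fineOp (L^nL^K) M a_{K+n} (L^nL^K)² m²)⁻¹` on refined sources `λ∘pr` with `(fineOp (L^K) M a_K (L^K)² m²)⁻¹` read at `pr x′`, with the rate
`(L^{−γ})^K` AND the decay `e^{−δ·dist(B(x), supp λ)}`, uniformly in `K, n`, the volume and `m² ∈ (0, m₀²]`.  THIS FILE reads them at `m² → 0⁺` (both runs' inverses are continuous in the mass
at the invertible massless operator) and tensors with `1_ι`: the three FLAT TWO-GRID ROWS become theorems on King's torus family, in the pairing currency of n15-c∕235 (`idef (pull ∘ liftMap pr)`).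
* §1 plumbing: `kingPr_eq_underPtN` (rfl), `exists_nat_tdistT` (the torus block distance is an integer), `idef_pull_liftMap_tensorId` (the defect of Kronecker lifts is the lift of the defect),
  `gradFlat_mulVec_apply`, `hasMaj_of_kingDecay_nat` (220's transfer with King's INTEGER distance thresholds), `rpow_rate_pow` (`(L^{−2γ∕2})^K = (L^K)^{−γ}`);
* §2 ★★★ `flatTwoGridRow_green_king` (`G′(1)`: BS → BS), ★★★ `flatTwoGridRow_grad_king` (`∂G′(1)`: BS → BV), ★★★ `flatTwoGridRow_adjGrad_king` (`G′(1)∂ᵀ`: BV → BS) — each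
  `∃ C δ > 0 ∀ K ≥ 1 ∀ n ≥ 1 ∀ e, M = 2L^e ∀ k ι`: `HasMaj (ofBlocks (unitTorusGeo L k M) (liftBlk blk ι)) (ofBlocks … (liftBlk blk′ ι)) (idef P̂_in P̂_out T″ T′) (C·(L^K)^{−γ}·e^{−δ|y−y′|_T})`
  at the masses `a_K(a₀,L,K)·(L^K)^{d+1}` (coarse) ∕ `a_{n+K}(a₀,L,n+K)·(L^nL^K)^{d+1}` (fine; the level written `n + K` as in (♭-8a) `flatRows_two_grids`); ★★★ `flatTwoGridKernelRows_king` — the three rows with ONE constant block `(C, δ)`.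

HONEST FRAMING ∕ LIMITS.  The rows are King's `A = 0` MODEL statements ([King1986] template literature, Prop. 3.8 (3.71) + Thm 3.3 (3.7), typed and proved in the tree by dag-n15-e) read on
Bałaban's flat objects at `U ≡ 1` through an exact dictionary; periodic b.c., `K, n ≥ 1`, tori `2L^e`, odd `L ≥ 3`, rate exponent `γ < 1∕2` (currency), King's PAIRED couplings (`0 < a_K ≤ a₀`);
NOT [Balaban1985BackgroundPropagators] Thm 3.1 as printed (covariant, multiscale, weighted norms); NE2⁺ NOT PRINTED; N15 of record untouched (DISCHARGED AS CONSUMED, p687738); counts UNMOVED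
(typed 28∕28 · discharged 8∕27); one finite 𝕋⁴ at fixed ε per index — NOT infinite volume ∕ OS ∕ mass gap ∕ Clay.  Restate-immune (no Theses import).  No `sorry`, `instance`, `notation`;
standard axioms.
-/

noncomputable section

open scoped BigOperators Matrix Kronecker

namespace Summit.QuantumFields.YangMills.BalabanUVNodes.N15.CovLandau

open Literature.MathematicalPhysics.QuantumFieldTheory.Balaban1983to89
open Literature.MathematicalPhysics.QuantumFieldTheory.Balaban1983to89.B5Prop11Plancherel (Tor fine unitVec)
open Literature.MathematicalPhysics.QuantumFieldTheory.Balaban1983to89.B11SectG (BlockNorm HasMaj)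
open Literature.MathematicalPhysics.QuantumFieldTheory.Balaban1983to89.B11AxialTransport190 (abs_le_loc_ofBlocks loc_ofBlocks_le)
open Literature.MathematicalPhysics.QuantumFieldTheory.Balaban1983to89.B6UnitTorusCarrier (unitTorusGeo)
open Literature.MathematicalPhysics.QuantumFieldTheory.Balaban1983to89.T4EtaRateDefect (idef idef_apply)
open Literature.MathematicalPhysics.QuantumFieldTheory.Balaban1983to89.T4EtaRateCoeffDefect (pull pull_apply)
open Literature.MathematicalPhysics.QuantumFieldTheory.King1986 (aK aK_pos aK_le)
open Literature.MathematicalPhysics.QuantumFieldTheory.King1986.Torus (blockOf tdistT tdistT_nonneg fineOp)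
open Summit.QuantumFields.YangMills.BalabanUVNodes.N15.VectorPiece (tensorId tensorId_apply hasMaj_tensorId kingPr kingPrV kingPrV_eq)
open Summit.QuantumFields.YangMills.BalabanUVNodes.N15.MatrixSpecies (liftBlk liftMap)
open Summit.QuantumFields.YangMills.BalabanUVNodes.N15.TwoGrid (abs_le_of_Ioc)
open Summit.QuantumFields.YangMills.BalabanUVNodes.N15.SiteLayerBg (continuousAt_fineOp_inv_mulVec_mass)
open Summit.QuantumFields.YangMills.BalabanUVNodes.N15KingModelRung.Curved (underPtN blockOf_underPtN fullPropOp_rate_printed fullPropDOp_rate_printed fullPropAdjOp_rate_printed)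

variable {d : ℕ}

/-! ## §1 Plumbing: King's pairing, integer block distances, the defect of Kronecker lifts, the transfer with integer thresholds -/

section Plumbing

variable (L : ℕ) [NeZero L]

omit [NeZero L] in
/-- King's pairing of the lane (`VectorPiece.kingPr L K n M`, `x_μ = ⌊x′_μ∕L^n⌋`) IS the rung's `underPtN L K n M` (same text). [cite: King1986, p.664 («x′ ∈ B^n(x)»)] -/
theorem kingPr_eq_underPtN (K n : ℕ) (M : Fin (d + 1) → ℕ) : kingPr L K n M = underPtN L K n M := rfl

omit [NeZero L] in
/-- The torus block distance `|y − y′|_T` is a natural number (a sup of integer coordinate distances). [folklore] -/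
theorem exists_nat_tdistT (M : Fin (d + 1) → ℕ) [∀ μ, NeZero (M μ)] (y y' : Tor M) : ∃ D : ℕ, tdistT M y y' = D := ⟨_, rfl⟩

omit [NeZero L] in
/-- **The intertwining defect of two Kronecker lifts through lifted pairings is the Kronecker lift of the scalar defect**:
`𝔇(T″ ⊗ 1, T′ ⊗ 1) = 𝔇(T″, T′) ⊗ 1` for the transports `pull (pr × id_ι)`. [folklore] -/
theorem idef_pull_liftMap_tensorId {X₁ X₂ X₁' X₂' : Type} (ι : Type) (π₁ : X₁' → X₁) (π₂ : X₂' → X₂) (T' : (X₁' → ℝ) →ₗ[ℝ] (X₂' → ℝ)) (T : (X₁ → ℝ) →ₗ[ℝ] (X₂ → ℝ)) :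
    idef (pull (liftMap π₁ ι)) (pull (liftMap π₂ ι)) (tensorId ι T') (tensorId ι T) = tensorId ι (idef (pull π₁) (pull π₂) T' T) :=
  LinearMap.ext fun _ => funext fun _ => rfl

omit [NeZero L] in
/-- The flat gradient of a scalar field: `(∂f)(x, ν) = n·(f(x + e_ν) − f(x))`. [cite: Balaban1984PropagatorsI, (1.4) p.18] -/
theorem gradFlat_mulVec_apply (M : Fin (d + 1) → ℕ) [∀ μ, NeZero (M μ)] (n : ℕ) [NeZero n] (f : Tor (fine n M) → ℝ) (b : Tor (fine n M) × Fin (d + 1)) :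
    (gradFlat M n *ᵥ f) b = (n : ℝ) * (f (b.1 + unitVec (fine n M) b.2) - f b.1) := by
  rw [Matrix.mulVec, dotProduct]
  simp only [gradFlat_apply]
  rw [show (∑ y : Tor (fine n M), (n : ℝ) * ((if y = b.1 + unitVec (fine n M) b.2 then (1 : ℝ) else 0) - (if b.1 = y then 1 else 0)) * f y) =
      ∑ y : Tor (fine n M), ((if y = b.1 + unitVec (fine n M) b.2 then (n : ℝ) * f y else 0) - (if b.1 = y then (n : ℝ) * f y else 0)) from
    Finset.sum_congr rfl fun y _ => by split_ifs <;> ring]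
  rw [Finset.sum_sub_distrib, Finset.sum_ite_eq' Finset.univ, Finset.sum_ite_eq Finset.univ]
  simp only [Finset.mem_univ, if_true]
  ring

omit [NeZero L] in
/-- **220's transfer with INTEGER thresholds.**  From a King-style `(D, F)`-decay statement quantified over natural `D` (the rung's currency) to a sharp-block majorant: the block of the
observation point and the block of the source are at the integer distance `D = |y − y′|_T`. [folklore] -/
theorem hasMaj_of_kingDecay_nat {M : Fin (d + 1) → ℕ} [∀ μ, NeZero (M μ)] (k : ℕ) {X₁ X₂ : Type} [Fintype X₁] [Fintype X₂] (blk₁ : X₁ → Tor M) (blk₂ : X₂ → Tor M)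
    (T : (X₁ → ℝ) →ₗ[ℝ] (X₂ → ℝ)) {C δ : ℝ} (hC : 0 ≤ C)
    (h : ∀ (lam : X₁ → ℝ) (F : ℝ) (D : ℕ), (∀ y, |lam y| ≤ F) → ∀ x₂ : X₂, (∀ y, lam y ≠ 0 → (D : ℝ) ≤ tdistT M (blk₂ x₂) (blk₁ y)) → |T lam x₂| ≤ C * Real.exp (-(δ * D)) * F) :
    HasMaj (BlockNorm.ofBlocks (unitTorusGeo L k M) blk₁) (BlockNorm.ofBlocks (unitTorusGeo L k M) blk₂) T (fun y y' => C * Real.exp (-(δ * tdistT M y y'))) := by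
  intro y' lam hlam y
  have hlam' : ∀ z, blk₁ z ≠ y' → lam z = 0 := hlam
  have hL0 := (BlockNorm.ofBlocks (unitTorusGeo L k M) blk₁).loc_nonneg y' lam
  have hF : ∀ z, |lam z| ≤ (BlockNorm.ofBlocks (unitTorusGeo L k M) blk₁).loc y' lam := by
    intro z
    by_cases hz : blk₁ z = y'
    · exact abs_le_loc_ofBlocks (g := unitTorusGeo L k M) blk₁ lam hz
    · rw [hlam' z hz, abs_zero]; exact hL0
  obtain ⟨D, hD⟩ := exists_nat_tdistT M y y'
  refine loc_ofBlocks_le (g := unitTorusGeo L k M) blk₂ _ (mul_nonneg (mul_nonneg hC (Real.exp_nonneg _)) hL0) fun x₂ hx₂ => ?_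
  have hmain := h lam _ D hF x₂ fun z hz => le_of_eq ?_
  · show |T lam x₂| ≤ C * Real.exp (-(δ * tdistT M y y')) * (BlockNorm.ofBlocks (unitTorusGeo L k M) blk₁).loc y' lam
    rw [hD]; exact hmain
  · have hzb : blk₁ z = y' := by by_contra hne; exact hz (hlam' z hne)
    rw [hx₂, hzb, hD]

omit [NeZero L] in
/-- `(L^{−(2γ)∕2})^K = (L^K)^{−γ}` (the rung's rate read in the lane's currency). [folklore] -/
theorem rpow_rate_pow (γ : ℝ) (K : ℕ) : ((L : ℝ) ^ (-(2 * γ / 2))) ^ K = ((L : ℝ) ^ K) ^ (-γ) := by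
  have hL0 : (0 : ℝ) ≤ (L : ℝ) := Nat.cast_nonneg L
  rw [show -(2 * γ / 2) = -γ by ring, ← Real.rpow_natCast, ← Real.rpow_mul hL0, mul_comm, Real.rpow_mul hL0, Real.rpow_natCast]

end Plumbing

/-! ## §2 The three flat two-grid kernel rows from the King-model rung -/

section Rows

variable (L : ℕ) [NeZero L]

/-- ★★★ **THE FLAT TWO-GRID ROW OF `G′(1)`, HYPOTHESIS-FREE ON KING's TORUS FAMILY** (BS → BS).  For odd `L ≥ 3`, `a₀ > 0` and `0 ≤ γ < 1∕2` there are `C, δ > 0` such that for every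
`K ≥ 1`, `n ≥ 1`, every torus `M_μ = 2L^e`, every geometry label `k` and colour type `ι`, at the PAIRED masses `a_K·(L^K)^{d+1}` (coarse) ∕ `a_{K+n}·(L^nL^K)^{d+1}` (fine):
`|G″(1)(λ∘pr) − (G′(1)λ)∘pr|` has the block majorant `C·(L^K)^{−γ}·e^{−δ|y−y′|_T}` — dag-n15-e's `fullPropOp_rate_printed` at `m² → 0⁺`, tensored with `1_ι`.
[cite: King1986, Prop. 3.8 (3.71) p.664 (first line), Thm 3.3 (3.7) p.658, p.664 («x′ ∈ B^n(x)»), (4.5) p.670; Balaban1983RegularityDecay, Theorem (1.10) p.573; Balaban1985BackgroundPropagators, Thm 3.1 (3.42) p.397 (entry 0 at `U ≡ 1`: shape)] -/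
theorem flatTwoGridRow_green_king (hLodd : Odd L) (hL : 2 ≤ L) {a₀ : ℝ} (ha₀ : 0 < a₀) {γ : ℝ} (hγ0 : 0 ≤ γ) (hγ1 : γ < 1 / 2) :
    ∃ C δ : ℝ, 0 < C ∧ 0 < δ ∧ ∀ (K : ℕ), 1 ≤ K → ∀ (n : ℕ), 1 ≤ n → ∀ (e : ℕ) (M : Fin (d + 1) → ℕ) [∀ μ, NeZero (M μ)], (∀ μ, M μ = 2 * L ^ e) →
      ∀ (k : ℕ) (ι : Type) [Fintype ι] [DecidableEq ι],
        HasMaj (BlockNorm.ofBlocks (unitTorusGeo L k M) (liftBlk (blockOf (L ^ K) M) ι)) (BlockNorm.ofBlocks (unitTorusGeo L k M) (liftBlk (blockOf (L ^ n * L ^ K) M) ι))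
          (idef (pull (liftMap (kingPr L K n M) ι)) (pull (liftMap (kingPr L K n M) ι))
            (Matrix.mulVecLin (cGreen M (L ^ n * L ^ K) (fun (_ : Fin (d + 1)) (_ : Tor (fine (L ^ n * L ^ K) M)) => (1 : Matrix ι ι ℝ)) (aK a₀ (L : ℝ) (n + K) * ((L ^ n * L ^ K : ℕ) : ℝ) ^ (d + 1))))
            (Matrix.mulVecLin (cGreen M (L ^ K) (fun (_ : Fin (d + 1)) (_ : Tor (fine (L ^ K) M)) => (1 : Matrix ι ι ℝ)) (aK a₀ (L : ℝ) K * ((L ^ K : ℕ) : ℝ) ^ (d + 1)))))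
          (fun y y' => C * ((L : ℝ) ^ K) ^ (-γ) * Real.exp (-(δ * tdistT M y y'))) := by
  obtain ⟨C, δ, hC, hδ, H⟩ := fullPropOp_rate_printed (d := d) L hLodd hL ha₀ zero_le_one (γ := 2 * γ) (by linarith) (by linarith)
  refine ⟨C, δ, hC, hδ, ?_⟩
  intro K hK n hn e M _ hM k ι _ _
  rw [Nat.add_comm n K]
  have hL1r : (1 : ℝ) < L := by exact_mod_cast (lt_of_lt_of_le one_lt_two hL)
  have haK : 0 < aK a₀ (L : ℝ) K := aK_pos ha₀ hL1r hK
  have haK' : 0 < aK a₀ (L : ℝ) (K + n) := aK_pos ha₀ hL1r (le_add_right hK)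
  have hθ : 0 ≤ ((L : ℝ) ^ K) ^ (-γ) := Real.rpow_nonneg (pow_nonneg (Nat.cast_nonneg L) K) _
  -- the dictionary: both Green operators are King's massless inverses tensored with `1_ι`
  rw [cGreen_one, cGreen_one, greenFlat_eq_fineOp_inv, greenFlat_eq_fineOp_inv, mulVecLin_kronecker_one_rect, mulVecLin_kronecker_one_rect, idef_pull_liftMap_tensorId]
  have hrow := hasMaj_of_kingDecay_nat L k (blockOf (L ^ K) M) (blockOf (L ^ n * L ^ K) M)
    (idef (pull (kingPr L K n M)) (pull (kingPr L K n M)) (Matrix.mulVecLin (fineOp (L ^ n * L ^ K) M (aK a₀ (L : ℝ) (K + n)) ((((L ^ n * L ^ K : ℕ) : ℝ)) ^ 2) 0)⁻¹)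
      (Matrix.mulVecLin (fineOp (L ^ K) M (aK a₀ (L : ℝ) K) ((((L ^ K : ℕ) : ℝ)) ^ 2) 0)⁻¹)) (C := C * ((L : ℝ) ^ K) ^ (-γ)) (δ := δ) (mul_nonneg hC.le hθ) ?_
  · exact hasMaj_tensorId ι (fun y y' => by positivity) hrow
  intro lam F D hF x' hDx
  rw [idef_apply, Pi.sub_apply, pull_apply, Matrix.mulVecLin_apply, Matrix.mulVecLin_apply]
  -- the massless statement from the massive family by continuity at `m² = 0`
  have hc : ContinuousAt (fun m2 : ℝ => ((fineOp (L ^ n * L ^ K) M (aK a₀ (L : ℝ) (K + n)) ((((L ^ n * L ^ K : ℕ) : ℝ)) ^ 2) m2)⁻¹ *ᵥ (pull (kingPr L K n M) lam)) x'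
      - ((fineOp (L ^ K) M (aK a₀ (L : ℝ) K) ((((L ^ K : ℕ) : ℝ)) ^ 2) m2)⁻¹ *ᵥ lam) (kingPr L K n M x')) 0 :=
    (continuousAt_fineOp_inv_mulVec_mass M (L ^ n * L ^ K) haK' _ x').sub (continuousAt_fineOp_inv_mulVec_mass M (L ^ K) haK lam _)
  have hk := abs_le_of_Ioc one_pos hc fun m2 hm2 hm2' => H K hK n hn e M hM m2 hm2 hm2' lam F hF D x' fun y hy => (hDx y hy).trans_eq (by rw [blockOf_underPtN])
  rw [rpow_rate_pow] at hk
  simpa only [mul_assoc] using hk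

/-- ★★★ **THE FLAT TWO-GRID ROW OF `∂G′(1)`, HYPOTHESIS-FREE ON KING's TORUS FAMILY** (BS → BV; output pairing on bonds `kingPrV`): same quantifiers and masses as `flatTwoGridRow_green_king`;
`|∂″G″(1)(λ∘pr) − (∂′G′(1)λ)∘prV|` has the block majorant `C·(L^K)^{−γ}·e^{−δ|y−y′|_T}` — dag-n15-e's `fullPropDOp_rate_printed` at `m² → 0⁺`, tensored with `1_ι`.
[cite: King1986, Prop. 3.8 (3.71) p.664 (second line), Thm 3.3 (3.7) p.658, p.664; Balaban1983RegularityDecay, Theorem (1.10) p.573; Balaban1985BackgroundPropagators, Thm 3.1 (3.42) p.397 (entry 1 at `U ≡ 1`: shape)] -/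
theorem flatTwoGridRow_grad_king (hLodd : Odd L) (hL : 2 ≤ L) {a₀ : ℝ} (ha₀ : 0 < a₀) {γ : ℝ} (hγ0 : 0 ≤ γ) (hγ1 : γ < 1 / 2) :
    ∃ C δ : ℝ, 0 < C ∧ 0 < δ ∧ ∀ (K : ℕ), 1 ≤ K → ∀ (n : ℕ), 1 ≤ n → ∀ (e : ℕ) (M : Fin (d + 1) → ℕ) [∀ μ, NeZero (M μ)], (∀ μ, M μ = 2 * L ^ e) →
      ∀ (k : ℕ) (ι : Type) [Fintype ι] [DecidableEq ι],
        HasMaj (BlockNorm.ofBlocks (unitTorusGeo L k M) (liftBlk (blockOf (L ^ K) M) ι))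
          (BlockNorm.ofBlocks (unitTorusGeo L k M) (liftBlk (fun b : Tor (fine (L ^ n * L ^ K) M) × Fin (d + 1) => blockOf (L ^ n * L ^ K) M b.1) ι))
          (idef (pull (liftMap (kingPr L K n M) ι)) (pull (liftMap (kingPrV L K n M) ι))
            (Matrix.mulVecLin (cgrad M (L ^ n * L ^ K) (fun (_ : Fin (d + 1)) (_ : Tor (fine (L ^ n * L ^ K) M)) => (1 : Matrix ι ι ℝ)) *
              cGreen M (L ^ n * L ^ K) (fun (_ : Fin (d + 1)) (_ : Tor (fine (L ^ n * L ^ K) M)) => (1 : Matrix ι ι ℝ)) (aK a₀ (L : ℝ) (n + K) * ((L ^ n * L ^ K : ℕ) : ℝ) ^ (d + 1))))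
            (Matrix.mulVecLin (cgrad M (L ^ K) (fun (_ : Fin (d + 1)) (_ : Tor (fine (L ^ K) M)) => (1 : Matrix ι ι ℝ)) *
              cGreen M (L ^ K) (fun (_ : Fin (d + 1)) (_ : Tor (fine (L ^ K) M)) => (1 : Matrix ι ι ℝ)) (aK a₀ (L : ℝ) K * ((L ^ K : ℕ) : ℝ) ^ (d + 1)))))
          (fun y y' => C * ((L : ℝ) ^ K) ^ (-γ) * Real.exp (-(δ * tdistT M y y'))) := by
  obtain ⟨C, δ, hC, hδ, H⟩ := fullPropDOp_rate_printed (d := d) L hLodd hL ha₀ zero_le_one (γ := 2 * γ) (by linarith) (by linarith)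
  refine ⟨C, δ, hC, hδ, ?_⟩
  intro K hK n hn e M _ hM k ι _ _
  rw [Nat.add_comm n K]
  have hL1r : (1 : ℝ) < L := by exact_mod_cast (lt_of_lt_of_le one_lt_two hL)
  have haK : 0 < aK a₀ (L : ℝ) K := aK_pos ha₀ hL1r hK
  have haK' : 0 < aK a₀ (L : ℝ) (K + n) := aK_pos ha₀ hL1r (le_add_right hK)
  have hθ : 0 ≤ ((L : ℝ) ^ K) ^ (-γ) := Real.rpow_nonneg (pow_nonneg (Nat.cast_nonneg L) K) _
  have hop : ∀ (N : ℕ) [NeZero N] (a' : ℝ), cgrad M N (fun (_ : Fin (d + 1)) (_ : Tor (fine N M)) => (1 : Matrix ι ι ℝ)) * cGreen M N (fun (_ : Fin (d + 1)) (_ : Tor (fine N M)) => (1 : Matrix ι ι ℝ)) (a' * (N : ℝ) ^ (d + 1)) =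
      (gradFlat M N * (fineOp N M a' (((N : ℕ) : ℝ) ^ 2) 0)⁻¹) ⊗ₖ (1 : Matrix ι ι ℝ) := fun N _ a' => by
    rw [cGreen_one, greenFlat_eq_fineOp_inv, cgrad_one, ← Matrix.mul_kronecker_mul, Matrix.mul_one]
  rw [hop, hop, mulVecLin_kronecker_one_rect, mulVecLin_kronecker_one_rect, idef_pull_liftMap_tensorId]
  have hrow := hasMaj_of_kingDecay_nat L k (blockOf (L ^ K) M) (fun b : Tor (fine (L ^ n * L ^ K) M) × Fin (d + 1) => blockOf (L ^ n * L ^ K) M b.1)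
    (idef (pull (kingPr L K n M)) (pull (kingPrV L K n M)) (Matrix.mulVecLin (gradFlat M (L ^ n * L ^ K) * (fineOp (L ^ n * L ^ K) M (aK a₀ (L : ℝ) (K + n)) ((((L ^ n * L ^ K : ℕ) : ℝ)) ^ 2) 0)⁻¹))
      (Matrix.mulVecLin (gradFlat M (L ^ K) * (fineOp (L ^ K) M (aK a₀ (L : ℝ) K) ((((L ^ K : ℕ) : ℝ)) ^ 2) 0)⁻¹))) (C := C * ((L : ℝ) ^ K) ^ (-γ)) (δ := δ) (mul_nonneg hC.le hθ) ?_
  · exact hasMaj_tensorId ι (fun y y' => by positivity) hrow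
  intro lam F D hF b' hDx
  rw [idef_apply, Pi.sub_apply, pull_apply, Matrix.mulVecLin_apply, Matrix.mulVecLin_apply, ← Matrix.mulVec_mulVec, ← Matrix.mulVec_mulVec, gradFlat_mulVec_apply, kingPrV_eq, gradFlat_mulVec_apply]
  -- the massless statement from the massive family by continuity at `m² = 0`
  have hc : ContinuousAt (fun m2 : ℝ =>
      ((L ^ n * L ^ K : ℕ) : ℝ) * (((fineOp (L ^ n * L ^ K) M (aK a₀ (L : ℝ) (K + n)) ((((L ^ n * L ^ K : ℕ) : ℝ)) ^ 2) m2)⁻¹ *ᵥ (pull (kingPr L K n M) lam)) (b'.1 + unitVec (fine (L ^ n * L ^ K) M) b'.2)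
        - ((fineOp (L ^ n * L ^ K) M (aK a₀ (L : ℝ) (K + n)) ((((L ^ n * L ^ K : ℕ) : ℝ)) ^ 2) m2)⁻¹ *ᵥ (pull (kingPr L K n M) lam)) b'.1)
      - ((L ^ K : ℕ) : ℝ) * (((fineOp (L ^ K) M (aK a₀ (L : ℝ) K) ((((L ^ K : ℕ) : ℝ)) ^ 2) m2)⁻¹ *ᵥ lam) (kingPr L K n M b'.1 + unitVec (fine (L ^ K) M) b'.2)
        - ((fineOp (L ^ K) M (aK a₀ (L : ℝ) K) ((((L ^ K : ℕ) : ℝ)) ^ 2) m2)⁻¹ *ᵥ lam) (kingPr L K n M b'.1))) 0 :=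
    (continuousAt_const.mul ((continuousAt_fineOp_inv_mulVec_mass M (L ^ n * L ^ K) haK' _ _).sub (continuousAt_fineOp_inv_mulVec_mass M (L ^ n * L ^ K) haK' _ _))).sub
      (continuousAt_const.mul ((continuousAt_fineOp_inv_mulVec_mass M (L ^ K) haK lam _).sub (continuousAt_fineOp_inv_mulVec_mass M (L ^ K) haK lam _)))
  have hk := abs_le_of_Ioc one_pos hc fun m2 hm2 hm2' => H K hK n hn e M hM m2 hm2 hm2' b'.2 lam F hF D b'.1 fun y hy => (hDx y hy).trans_eq (by rw [blockOf_underPtN])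
  rw [rpow_rate_pow] at hk
  simpa only [mul_assoc, Nat.cast_mul] using hk

/-- ★★★ **THE FLAT TWO-GRID ROW OF `G′(1)∂ᵀ`, HYPOTHESIS-FREE ON KING's TORUS FAMILY** (BV → BS; input pairing on bonds `kingPrV`): same quantifiers and masses as `flatTwoGridRow_green_king`;
`|G″(1)∂″ᵀ(ω∘prV) − (G′(1)∂′ᵀω)∘pr|` has the block majorant `C·(L^K)^{−γ}·e^{−δ|y−y′|_T}` — dag-n15-e's `fullPropAdjOp_rate_printed` (summation by parts: `G∂ᵀ_ν = G∇*_ν`) at `m² → 0⁺`, summed over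
the `d + 1` directions, tensored with `1_ι`.
[cite: King1986, Prop. 3.8 (3.71) p.664 (second line), Thm 3.3 (3.7) p.658, p.664; Balaban1983RegularityDecay, Theorem (1.10) p.573; Balaban1985BackgroundPropagators, Thm 3.1 (3.42) p.397 (entry 2 at `U ≡ 1`: shape)] -/
theorem flatTwoGridRow_adjGrad_king (hLodd : Odd L) (hL : 2 ≤ L) {a₀ : ℝ} (ha₀ : 0 < a₀) {γ : ℝ} (hγ0 : 0 ≤ γ) (hγ1 : γ < 1 / 2) :
    ∃ C δ : ℝ, 0 < C ∧ 0 < δ ∧ ∀ (K : ℕ), 1 ≤ K → ∀ (n : ℕ), 1 ≤ n → ∀ (e : ℕ) (M : Fin (d + 1) → ℕ) [∀ μ, NeZero (M μ)], (∀ μ, M μ = 2 * L ^ e) →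
      ∀ (k : ℕ) (ι : Type) [Fintype ι] [DecidableEq ι],
        HasMaj (BlockNorm.ofBlocks (unitTorusGeo L k M) (liftBlk (fun b : Tor (fine (L ^ K) M) × Fin (d + 1) => blockOf (L ^ K) M b.1) ι))
          (BlockNorm.ofBlocks (unitTorusGeo L k M) (liftBlk (blockOf (L ^ n * L ^ K) M) ι))
          (idef (pull (liftMap (kingPrV L K n M) ι)) (pull (liftMap (kingPr L K n M) ι))
            (Matrix.mulVecLin (cGreen M (L ^ n * L ^ K) (fun (_ : Fin (d + 1)) (_ : Tor (fine (L ^ n * L ^ K) M)) => (1 : Matrix ι ι ℝ)) (aK a₀ (L : ℝ) (n + K) * ((L ^ n * L ^ K : ℕ) : ℝ) ^ (d + 1)) *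
              (cgrad M (L ^ n * L ^ K) (fun (_ : Fin (d + 1)) (_ : Tor (fine (L ^ n * L ^ K) M)) => (1 : Matrix ι ι ℝ)))ᵀ))
            (Matrix.mulVecLin (cGreen M (L ^ K) (fun (_ : Fin (d + 1)) (_ : Tor (fine (L ^ K) M)) => (1 : Matrix ι ι ℝ)) (aK a₀ (L : ℝ) K * ((L ^ K : ℕ) : ℝ) ^ (d + 1)) *
              (cgrad M (L ^ K) (fun (_ : Fin (d + 1)) (_ : Tor (fine (L ^ K) M)) => (1 : Matrix ι ι ℝ)))ᵀ)))
          (fun y y' => C * ((L : ℝ) ^ K) ^ (-γ) * Real.exp (-(δ * tdistT M y y'))) := by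
  obtain ⟨C, δ, hC, hδ, H⟩ := fullPropAdjOp_rate_printed (d := d) L hLodd hL ha₀ zero_le_one (γ := 2 * γ) (by linarith) (by linarith)
  refine ⟨((d : ℝ) + 1) * C, δ, by positivity, hδ, ?_⟩
  intro K hK n hn e M _ hM k ι _ _
  rw [Nat.add_comm n K]
  have hL1r : (1 : ℝ) < L := by exact_mod_cast (lt_of_lt_of_le one_lt_two hL)
  have haK : 0 < aK a₀ (L : ℝ) K := aK_pos ha₀ hL1r hK
  have haK' : 0 < aK a₀ (L : ℝ) (K + n) := aK_pos ha₀ hL1r (le_add_right hK)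
  have hθ : 0 ≤ ((L : ℝ) ^ K) ^ (-γ) := Real.rpow_nonneg (pow_nonneg (Nat.cast_nonneg L) K) _
  have hop : ∀ (N : ℕ) [NeZero N] (a' : ℝ), cGreen M N (fun (_ : Fin (d + 1)) (_ : Tor (fine N M)) => (1 : Matrix ι ι ℝ)) (a' * (N : ℝ) ^ (d + 1)) * (cgrad M N (fun (_ : Fin (d + 1)) (_ : Tor (fine N M)) => (1 : Matrix ι ι ℝ)))ᵀ =
      ((fineOp N M a' (((N : ℕ) : ℝ) ^ 2) 0)⁻¹ * (gradFlat M N)ᵀ) ⊗ₖ (1 : Matrix ι ι ℝ) := fun N _ a' => by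
    rw [cGreen_one, greenFlat_eq_fineOp_inv, cgrad_one, ← Matrix.kroneckerMap_transpose, Matrix.transpose_one, ← Matrix.mul_kronecker_mul, Matrix.mul_one]
  rw [hop, hop, mulVecLin_kronecker_one_rect, mulVecLin_kronecker_one_rect, idef_pull_liftMap_tensorId]
  have hrow := hasMaj_of_kingDecay_nat L k (fun b : Tor (fine (L ^ K) M) × Fin (d + 1) => blockOf (L ^ K) M b.1) (blockOf (L ^ n * L ^ K) M)
    (idef (pull (kingPrV L K n M)) (pull (kingPr L K n M)) (Matrix.mulVecLin ((fineOp (L ^ n * L ^ K) M (aK a₀ (L : ℝ) (K + n)) ((((L ^ n * L ^ K : ℕ) : ℝ)) ^ 2) 0)⁻¹ * (gradFlat M (L ^ n * L ^ K))ᵀ))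
      (Matrix.mulVecLin ((fineOp (L ^ K) M (aK a₀ (L : ℝ) K) ((((L ^ K : ℕ) : ℝ)) ^ 2) 0)⁻¹ * (gradFlat M (L ^ K))ᵀ))) (C := ((d : ℝ) + 1) * C * ((L : ℝ) ^ K) ^ (-γ)) (δ := δ)
      (mul_nonneg (by positivity) hθ) ?_
  · exact hasMaj_tensorId ι (fun y y' => by positivity) hrow
  intro ω F D hF x' hDx
  have hF0 : 0 ≤ F := (abs_nonneg _).trans (hF (0, 0))
  rw [idef_apply, Pi.sub_apply, pull_apply, Matrix.mulVecLin_apply, Matrix.mulVecLin_apply, ← Matrix.mulVec_mulVec, ← Matrix.mulVec_mulVec]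
  -- the transposed gradients as sums over the directions
  have hsrc' : (gradFlat M (L ^ n * L ^ K))ᵀ *ᵥ (pull (kingPrV L K n M) ω) =
      ∑ ν : Fin (d + 1), fun z' => ((L ^ n * L ^ K : ℕ) : ℝ) * (ω (kingPr L K n M (z' - unitVec (fine (L ^ n * L ^ K) M) ν), ν) - ω (kingPr L K n M z', ν)) := by
    funext z'; rw [gradFlat_transpose_mulVec, Finset.sum_apply]; rfl
  have hsrc : (gradFlat M (L ^ K))ᵀ *ᵥ ω = ∑ ν : Fin (d + 1), fun z => ((L ^ K : ℕ) : ℝ) * (ω (z - unitVec (fine (L ^ K) M) ν, ν) - ω (z, ν)) := by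
    funext z; rw [gradFlat_transpose_mulVec, Finset.sum_apply]
  rw [hsrc', hsrc, Matrix.mulVec_sum, Matrix.mulVec_sum, Finset.sum_apply, Finset.sum_apply, ← Finset.sum_sub_distrib]
  -- one direction at a time: the rung's transposed-gradient rate at `m² → 0⁺`
  have hterm : ∀ ν : Fin (d + 1),
      |((fineOp (L ^ n * L ^ K) M (aK a₀ (L : ℝ) (K + n)) ((((L ^ n * L ^ K : ℕ) : ℝ)) ^ 2) 0)⁻¹ *ᵥ
            fun z' => ((L ^ n * L ^ K : ℕ) : ℝ) * (ω (kingPr L K n M (z' - unitVec (fine (L ^ n * L ^ K) M) ν), ν) - ω (kingPr L K n M z', ν))) x'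
        - ((fineOp (L ^ K) M (aK a₀ (L : ℝ) K) ((((L ^ K : ℕ) : ℝ)) ^ 2) 0)⁻¹ *ᵥ fun z => ((L ^ K : ℕ) : ℝ) * (ω (z - unitVec (fine (L ^ K) M) ν, ν) - ω (z, ν))) (kingPr L K n M x')|
        ≤ C * ((L : ℝ) ^ K) ^ (-γ) * Real.exp (-(δ * D)) * F := by
    intro ν
    have hc : ContinuousAt (fun m2 : ℝ =>
        ((fineOp (L ^ n * L ^ K) M (aK a₀ (L : ℝ) (K + n)) ((((L ^ n * L ^ K : ℕ) : ℝ)) ^ 2) m2)⁻¹ *ᵥ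
              fun z' => ((L ^ n * L ^ K : ℕ) : ℝ) * (ω (kingPr L K n M (z' - unitVec (fine (L ^ n * L ^ K) M) ν), ν) - ω (kingPr L K n M z', ν))) x'
          - ((fineOp (L ^ K) M (aK a₀ (L : ℝ) K) ((((L ^ K : ℕ) : ℝ)) ^ 2) m2)⁻¹ *ᵥ fun z => ((L ^ K : ℕ) : ℝ) * (ω (z - unitVec (fine (L ^ K) M) ν, ν) - ω (z, ν))) (kingPr L K n M x')) 0 :=
      (continuousAt_fineOp_inv_mulVec_mass M (L ^ n * L ^ K) haK' _ x').sub (continuousAt_fineOp_inv_mulVec_mass M (L ^ K) haK _ _)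
    have hk := abs_le_of_Ioc one_pos hc fun m2 hm2 hm2' =>
      H K hK n hn e M hM m2 hm2 hm2' ν (fun y => ω (y, ν)) F (fun y => hF (y, ν)) D x' fun y hy => (hDx (y, ν) hy).trans_eq (by rw [blockOf_underPtN])
    rw [rpow_rate_pow] at hk
    simpa only [mul_assoc] using hk
  calc |∑ ν : Fin (d + 1), (((fineOp (L ^ n * L ^ K) M (aK a₀ (L : ℝ) (K + n)) ((((L ^ n * L ^ K : ℕ) : ℝ)) ^ 2) 0)⁻¹ *ᵥ
            fun z' => ((L ^ n * L ^ K : ℕ) : ℝ) * (ω (kingPr L K n M (z' - unitVec (fine (L ^ n * L ^ K) M) ν), ν) - ω (kingPr L K n M z', ν))) x'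
          - ((fineOp (L ^ K) M (aK a₀ (L : ℝ) K) ((((L ^ K : ℕ) : ℝ)) ^ 2) 0)⁻¹ *ᵥ fun z => ((L ^ K : ℕ) : ℝ) * (ω (z - unitVec (fine (L ^ K) M) ν, ν) - ω (z, ν))) (kingPr L K n M x'))|
      ≤ ∑ ν : Fin (d + 1), C * ((L : ℝ) ^ K) ^ (-γ) * Real.exp (-(δ * D)) * F := (Finset.abs_sum_le_sum_abs _ _).trans (Finset.sum_le_sum fun ν _ => hterm ν)
    _ = ((d : ℝ) + 1) * C * ((L : ℝ) ^ K) ^ (-γ) * Real.exp (-(δ * D)) * F := by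
        rw [Finset.sum_const, Finset.card_univ, Fintype.card_fin, nsmul_eq_mul]; push_cast; ring

/-- ★★★ **THE THREE FLAT TWO-GRID KERNEL ROWS FROM THE KING-MODEL RUNG, ONE CONSTANT BLOCK, HYPOTHESIS-FREE ON KING's TORUS FAMILY.**  For odd `L ≥ 3`, `a₀ > 0` and `0 ≤ γ < 1∕2` there are
`C, δ > 0` such that for every `K ≥ 1`, `n ≥ 1`, every torus `M_μ = 2L^e`, every geometry label `k` and colour type `ι`, at the PAIRED masses `a_K(a₀, L, K)·(L^K)^{d+1}` (coarse run `L^K`) ∕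
`a_{n+K}(a₀, L, n+K)·(L^nL^K)^{d+1}` (fine run `L^nL^K`), with King's pairing `P̂ = pull ∘ liftMap (kingPr ∕ kingPrV)`: the η-defects `G″(1)P̂ − P̂G′(1)` (BS → BS), `∂″G″(1)P̂ − P̂∂′G′(1)`
(BS → BV), `G″(1)∂″ᵀP̂ − P̂G′(1)∂′ᵀ` (BV → BS) ALL have the block majorant `C·(L^K)^{−γ}·e^{−δ|y−y′|_T}` — the two-grid twin of n15-c∕220 `flatKernelRows_king`.
[cite: King1986, Prop. 3.8 (3.71) p.664, Thm 3.3 (3.7) p.658, p.664 («x′ ∈ B^n(x)»), (4.5) p.670; Balaban1983RegularityDecay, Theorem (1.10) p.573; Balaban1985BackgroundPropagators, Thm 3.1 (3.42) p.397 (entries 0–2 at `U ≡ 1`: shape)] -/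
theorem flatTwoGridKernelRows_king (hLodd : Odd L) (hL : 2 ≤ L) {a₀ : ℝ} (ha₀ : 0 < a₀) {γ : ℝ} (hγ0 : 0 ≤ γ) (hγ1 : γ < 1 / 2) :
    ∃ C δ : ℝ, 0 < C ∧ 0 < δ ∧ ∀ (K : ℕ), 1 ≤ K → ∀ (n : ℕ), 1 ≤ n → ∀ (e : ℕ) (M : Fin (d + 1) → ℕ) [∀ μ, NeZero (M μ)], (∀ μ, M μ = 2 * L ^ e) →
      ∀ (k : ℕ) (ι : Type) [Fintype ι] [DecidableEq ι],
        HasMaj (BlockNorm.ofBlocks (unitTorusGeo L k M) (liftBlk (blockOf (L ^ K) M) ι)) (BlockNorm.ofBlocks (unitTorusGeo L k M) (liftBlk (blockOf (L ^ n * L ^ K) M) ι))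
          (idef (pull (liftMap (kingPr L K n M) ι)) (pull (liftMap (kingPr L K n M) ι))
            (Matrix.mulVecLin (cGreen M (L ^ n * L ^ K) (fun (_ : Fin (d + 1)) (_ : Tor (fine (L ^ n * L ^ K) M)) => (1 : Matrix ι ι ℝ)) (aK a₀ (L : ℝ) (n + K) * ((L ^ n * L ^ K : ℕ) : ℝ) ^ (d + 1))))
            (Matrix.mulVecLin (cGreen M (L ^ K) (fun (_ : Fin (d + 1)) (_ : Tor (fine (L ^ K) M)) => (1 : Matrix ι ι ℝ)) (aK a₀ (L : ℝ) K * ((L ^ K : ℕ) : ℝ) ^ (d + 1)))))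
          (fun y y' => C * ((L : ℝ) ^ K) ^ (-γ) * Real.exp (-(δ * tdistT M y y'))) ∧
        HasMaj (BlockNorm.ofBlocks (unitTorusGeo L k M) (liftBlk (blockOf (L ^ K) M) ι))
          (BlockNorm.ofBlocks (unitTorusGeo L k M) (liftBlk (fun b : Tor (fine (L ^ n * L ^ K) M) × Fin (d + 1) => blockOf (L ^ n * L ^ K) M b.1) ι))
          (idef (pull (liftMap (kingPr L K n M) ι)) (pull (liftMap (kingPrV L K n M) ι))
            (Matrix.mulVecLin (cgrad M (L ^ n * L ^ K) (fun (_ : Fin (d + 1)) (_ : Tor (fine (L ^ n * L ^ K) M)) => (1 : Matrix ι ι ℝ)) *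
              cGreen M (L ^ n * L ^ K) (fun (_ : Fin (d + 1)) (_ : Tor (fine (L ^ n * L ^ K) M)) => (1 : Matrix ι ι ℝ)) (aK a₀ (L : ℝ) (n + K) * ((L ^ n * L ^ K : ℕ) : ℝ) ^ (d + 1))))
            (Matrix.mulVecLin (cgrad M (L ^ K) (fun (_ : Fin (d + 1)) (_ : Tor (fine (L ^ K) M)) => (1 : Matrix ι ι ℝ)) *
              cGreen M (L ^ K) (fun (_ : Fin (d + 1)) (_ : Tor (fine (L ^ K) M)) => (1 : Matrix ι ι ℝ)) (aK a₀ (L : ℝ) K * ((L ^ K : ℕ) : ℝ) ^ (d + 1)))))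
          (fun y y' => C * ((L : ℝ) ^ K) ^ (-γ) * Real.exp (-(δ * tdistT M y y'))) ∧
        HasMaj (BlockNorm.ofBlocks (unitTorusGeo L k M) (liftBlk (fun b : Tor (fine (L ^ K) M) × Fin (d + 1) => blockOf (L ^ K) M b.1) ι))
          (BlockNorm.ofBlocks (unitTorusGeo L k M) (liftBlk (blockOf (L ^ n * L ^ K) M) ι))
          (idef (pull (liftMap (kingPrV L K n M) ι)) (pull (liftMap (kingPr L K n M) ι))
            (Matrix.mulVecLin (cGreen M (L ^ n * L ^ K) (fun (_ : Fin (d + 1)) (_ : Tor (fine (L ^ n * L ^ K) M)) => (1 : Matrix ι ι ℝ)) (aK a₀ (L : ℝ) (n + K) * ((L ^ n * L ^ K : ℕ) : ℝ) ^ (d + 1)) *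
              (cgrad M (L ^ n * L ^ K) (fun (_ : Fin (d + 1)) (_ : Tor (fine (L ^ n * L ^ K) M)) => (1 : Matrix ι ι ℝ)))ᵀ))
            (Matrix.mulVecLin (cGreen M (L ^ K) (fun (_ : Fin (d + 1)) (_ : Tor (fine (L ^ K) M)) => (1 : Matrix ι ι ℝ)) (aK a₀ (L : ℝ) K * ((L ^ K : ℕ) : ℝ) ^ (d + 1)) *
              (cgrad M (L ^ K) (fun (_ : Fin (d + 1)) (_ : Tor (fine (L ^ K) M)) => (1 : Matrix ι ι ℝ)))ᵀ)))
          (fun y y' => C * ((L : ℝ) ^ K) ^ (-γ) * Real.exp (-(δ * tdistT M y y'))) := by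
  obtain ⟨C₀, δ₀, hC₀, hδ₀, H₀⟩ := flatTwoGridRow_green_king (d := d) L hLodd hL ha₀ hγ0 hγ1
  obtain ⟨C₁, δ₁, hC₁, hδ₁, H₁⟩ := flatTwoGridRow_grad_king (d := d) L hLodd hL ha₀ hγ0 hγ1
  obtain ⟨C₂, δ₂, hC₂, hδ₂, H₂⟩ := flatTwoGridRow_adjGrad_king (d := d) L hLodd hL ha₀ hγ0 hγ1
  refine ⟨max (max C₀ C₁) C₂, min (min δ₀ δ₁) δ₂, lt_max_of_lt_left (lt_max_of_lt_left hC₀), lt_min (lt_min hδ₀ hδ₁) hδ₂, ?_⟩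
  intro K hK n hn e M _ hM k ι _ _
  have hθ : 0 ≤ ((L : ℝ) ^ K) ^ (-γ) := Real.rpow_nonneg (pow_nonneg (Nat.cast_nonneg L) K) _
  have hmono : ∀ (c δ' : ℝ) (y y' : Tor M), c ≤ max (max C₀ C₁) C₂ → min (min δ₀ δ₁) δ₂ ≤ δ' →
      c * ((L : ℝ) ^ K) ^ (-γ) * Real.exp (-(δ' * tdistT M y y')) ≤ max (max C₀ C₁) C₂ * ((L : ℝ) ^ K) ^ (-γ) * Real.exp (-(min (min δ₀ δ₁) δ₂ * tdistT M y y')) :=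
    fun c δ' y y' hc hδ' => mul_le_mul (mul_le_mul_of_nonneg_right hc hθ) (Real.exp_le_exp.mpr (by nlinarith [tdistT_nonneg M y y'])) (Real.exp_nonneg _)
      (mul_nonneg ((hC₀.le.trans (le_max_left _ _)).trans (le_max_left _ _)) hθ)
  exact ⟨(H₀ K hK n hn e M hM k ι).mono fun y y' => hmono C₀ δ₀ y y' ((le_max_left _ _).trans (le_max_left _ _)) ((min_le_left _ _).trans (min_le_left _ _)),
    (H₁ K hK n hn e M hM k ι).mono fun y y' => hmono C₁ δ₁ y y' ((le_max_right _ _).trans (le_max_left _ _)) ((min_le_left _ _).trans (min_le_right _ _)),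
    (H₂ K hK n hn e M hM k ι).mono fun y y' => hmono C₂ δ₂ y y' (le_max_right _ _) (min_le_right _ _)⟩

end Rows

end Summit.QuantumFields.YangMills.BalabanUVNodes.N15.CovLandau

end
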